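import Summits.ResolutionOfSingularities.ResolutionOfSingularities.Theorems.ValuativeTorsorToLurelFfiniteTransport
import Mathlib.FieldTheory.PurelyInseparable.Exponent
import Mathlib.FieldTheory.IntermediateField.Adjoin.Basic
import Mathlib.RingTheory.Adjoin.FG

/-!
# `Valuative.TorsorToLurelFfinite`: Frobenius transport of a chart (Temkin 2013, Rem. 1.3.5 (i))

Route `ResolutionOfSingularities/Valuative`, support item `TorsorToLurelFfinite`
(stmt-ResolutionOfSingularities-0643). Helper file.

Setting: `k ⊆ K ⊆ L` fields of characteristic `p`, `L/K` finite purely inseparable, `n` at least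
the exponent of `L/K`, and `ρ : L →+* K` Mathlib's `IsPurelyInseparable.iterateFrobenius`, the ring
homomorphism with `ρ x = x^{pⁿ}` (read in `K`). For a valuation ring `O` of `K` with (unique)
extension `O'` to `L` and a subring `N ⊆ O'` (in the application: Temkin's `L`-normalisation
`Nr_L(X')`, regular at the centre of `O'`):

* `comap_iterateFrobenius_eq` — `O' = ρ⁻¹ O`;
* `map_iterateFrobenius_le`, `isRegularLocalRing_centre_map_iterateFrobenius` — `ρ(N) ⊆ O`, and
  `ρ(N)` is regular at the centre of `O` iff `N` is regular at the centre of `O'` (`ρ : N ≅ ρ(N)`);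
* the ground field `k^{pⁿ} ⊆ K` is the subfield
  `((algebraMap k K).comp (iterateFrobenius k p n)).fieldRange` (isomorphic to `k`, inside the image
  of `k`; `mem_frobeniusBaseField_iff`), and `exists_subalgebra_frobeniusBaseField` — if `N` is a
  finitely generated `k`-algebra then `ρ(N)` is
  a finitely generated `k^{pⁿ}`-algebra;
* `pow_mem_adjoin_of_isFractionRing` — if `Frac N = L` then `x^{pⁿ} ∈ k^{pⁿ}(ρ(N))` for every
  `x ∈ K` (i.e. `K^{pⁿ} ⊆ Frac ρ(N)`), and `pow_mem_of_algebraMap_mem` — `x^{pⁿ} ∈ ρ(N)` whenever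
  `x ∈ N ∩ K`.
-/

noncomputable section

set_option linter.dupNamespace false -- mandated namespace of this single-conjunct summit

open IsLocalRing

namespace Summit.ResolutionOfSingularities.ResolutionOfSingularities.Theorems

universe u

/-- In a valuation ring, `x ^ m ∈ O ↔ x ∈ O` for `m ≠ 0`. -/
theorem valuationSubring_pow_mem_iff {L : Type u} [Field L] (O : ValuationSubring L) {m : ℕ}
    (hm : m ≠ 0) (x : L) : x ^ m ∈ O ↔ x ∈ O := by
  rw [← O.valuation_le_one_iff, ← O.valuation_le_one_iff, map_pow, pow_le_one_iff hm]

section Frobenius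

variable {K L : Type u} [Field K] [Field L] [Algebra K L] (p : ℕ) [Fact p.Prime] [CharP K p]
  [IsPurelyInseparable.HasExponent K L] {n : ℕ} (hn : IsPurelyInseparable.exponent K L ≤ n)

/-- **The extension of `O` to `L` is the Frobenius pull-back of `O`.** If `O'` is a valuation
ring of `L` over the valuation ring `O` of `K` and `ρ x = x^{pⁿ} : L → K`, then `ρ⁻¹ O = O'`
(`x ∈ O' ↔ x^{pⁿ} ∈ O' ∩ K = O`). -/
theorem comap_iterateFrobenius_eq (O : ValuationSubring K) (O' : ValuationSubring L)
    (hO' : O'.comap (algebraMap K L) = O) :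
    O.comap (IsPurelyInseparable.iterateFrobenius K L p hn) = O' := by
  ext x
  rw [ValuationSubring.mem_comap]
  conv_lhs => rw [← hO', ValuationSubring.mem_comap,
    IsPurelyInseparable.algebraMap_iterateFrobenius K p hn]
  exact valuationSubring_pow_mem_iff O' (pow_ne_zero n (Nat.Prime.ne_zero Fact.out)) x

/-- `ρ(N) ⊆ O` for `N ⊆ O' = ρ⁻¹ O`. -/
theorem map_iterateFrobenius_le (O : ValuationSubring K) (N : Subring L)
    (hN : N ≤ (O.comap (IsPurelyInseparable.iterateFrobenius K L p hn)).toSubring) :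
    N.map (IsPurelyInseparable.iterateFrobenius K L p hn) ≤ O.toSubring := by
  rintro _ ⟨x, hx, rfl⟩
  exact hN hx

/-- **Frobenius transport of regularity at the centre** (Temkin 2013, Rem. 1.3.5 (i): the
Frobenius "maps the center of `K°` to a regular point"): `ρ` restricts to a ring isomorphism
`N ≅ ρ(N)` matching the centres of `O' = ρ⁻¹ O` and `O`, so `ρ(N)` is regular at the centre of `O`
iff `N` is regular at the centre of `O'`. -/
theorem isRegularLocalRing_centre_map_iterateFrobenius (O : ValuationSubring K) (N : Subring L)
    (hN : N ≤ (O.comap (IsPurelyInseparable.iterateFrobenius K L p hn)).toSubring)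
    (A₀ : Subring K) (hA₀ : N.map (IsPurelyInseparable.iterateFrobenius K L p hn) = A₀)
    (h₀ : A₀ ≤ O.toSubring) :
    IsRegularLocalRing (Localization.AtPrime (Ideal.comap (Subring.inclusion hN)
        (maximalIdeal ↥(O.comap (IsPurelyInseparable.iterateFrobenius K L p hn))))) ↔
      IsRegularLocalRing (Localization.AtPrime
        (Ideal.comap (Subring.inclusion h₀) (maximalIdeal ↥O))) :=
  isRegularLocalRing_centre_map_iff _ O N A₀ hA₀ hN h₀

/-- `x^{pⁿ} ∈ ρ(N)` for `x ∈ K` with `x ∈ N` (inside `L`). -/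
theorem pow_mem_of_algebraMap_mem (N : Subring L) (x : K) (hx : algebraMap K L x ∈ N) :
    x ^ p ^ n ∈ N.map (IsPurelyInseparable.iterateFrobenius K L p hn) :=
  ⟨algebraMap K L x, hx, IsPurelyInseparable.iterateFrobenius_algebraMap L p hn x⟩

end Frobenius

section BaseField

variable (k K : Type u) [Field k] [Field K] [Algebra k K] (p : ℕ) [Fact p.Prime] [CharP k p]
  (n : ℕ)

variable {k K p n}

/-- Membership in `k^{pⁿ}`. -/
theorem mem_frobeniusBaseField_iff {x : K} :
    x ∈ ((algebraMap k K).comp (iterateFrobenius k p n)).fieldRange ↔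
      ∃ c : k, algebraMap k K c ^ p ^ n = x := by
  simp [RingHom.mem_fieldRange, iterateFrobenius_def]

/-- `k^{pⁿ}` lies in (the image of) `k`. -/
theorem frobeniusBaseField_le_range :
    (((algebraMap k K).comp (iterateFrobenius k p n)).fieldRange : Set K) ⊆
      Set.range (algebraMap k K) := by
  rintro x hx
  obtain ⟨c, rfl⟩ := mem_frobeniusBaseField_iff.mp hx
  exact ⟨c ^ p ^ n, by rw [map_pow]⟩

/-- `(algebraMap k K c)^{pⁿ} ∈ k^{pⁿ}`. -/
theorem algebraMap_pow_mem_frobeniusBaseField (c : k) :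
    algebraMap k K c ^ p ^ n ∈ ((algebraMap k K).comp (iterateFrobenius k p n)).fieldRange :=
  mem_frobeniusBaseField_iff.mpr ⟨c, rfl⟩

variable [CharP K p] {L : Type u} [Field L] [Algebra K L] [Algebra k L] [IsScalarTower k K L]
  [IsPurelyInseparable.HasExponent K L] (hn : IsPurelyInseparable.exponent K L ≤ n)

/-- On `k ⊆ L`, the Frobenius `ρ : L → K` is `c ↦ c^{pⁿ}`. -/
theorem iterateFrobenius_comp_algebraMap :
    (IsPurelyInseparable.iterateFrobenius K L p hn).comp (algebraMap k L) =
      (algebraMap k K).comp (iterateFrobenius k p n) := by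
  ext c
  simp only [RingHom.coe_comp, Function.comp_apply, iterateFrobenius_def, map_pow]
  rw [IsScalarTower.algebraMap_apply k K L, IsPurelyInseparable.iterateFrobenius_algebraMap L p hn]

/-- **`ρ(N)` is a finitely generated `k^{pⁿ}`-algebra** when `N ⊆ L` is a finitely generated
`k`-algebra: if `N = k[g₁, …, g_m]` then `ρ(N) = k^{pⁿ}[ρ g₁, …, ρ g_m]`. -/
theorem exists_subalgebra_frobeniusBaseField (N : Subalgebra k L) (hN : N.FG) :
    ∃ A₀ : Subalgebra (((algebraMap k K).comp (iterateFrobenius k p n)).fieldRange) K,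
      A₀.toSubring = N.toSubring.map (IsPurelyInseparable.iterateFrobenius K L p hn) ∧ A₀.FG := by
  classical
  obtain ⟨S, hS⟩ := hN
  set ρ := IsPurelyInseparable.iterateFrobenius K L p hn with hρ
  refine ⟨Algebra.adjoin _ ((S.image ρ : Finset K) : Set K), ?_, Subalgebra.fg_adjoin_finset _⟩
  rw [Algebra.adjoin_eq_ring_closure, ← hS, Algebra.adjoin_eq_ring_closure, RingHom.map_closure,
    Set.image_union, ← Set.range_comp, Finset.coe_image]
  congr 2
  ext x
  rw [← RingHom.coe_comp, iterateFrobenius_comp_algebraMap]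
  constructor
  · rintro ⟨c, rfl⟩
    obtain ⟨a, ha⟩ := mem_frobeniusBaseField_iff.mp c.2
    refine ⟨a, ?_⟩
    rw [RingHom.comp_apply, iterateFrobenius_def, map_pow, ha]
    rfl
  · rintro ⟨c, rfl⟩
    exact ⟨⟨_, (((algebraMap k K).comp (iterateFrobenius k p n))).mem_fieldRange_self c⟩, rfl⟩

omit [Algebra k L] [IsScalarTower k K L] in
/-- **`K^{pⁿ} ⊆ Frac ρ(N)`**: if `Frac N = L` (every element of `L` is a quotient of elements of
`N`) and `A₀ = ρ(N)` as a `k^{pⁿ}`-subalgebra of `K`, then `x^{pⁿ} ∈ k^{pⁿ}(A₀)` for every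
`x ∈ K`. -/
theorem pow_mem_adjoin_of_isFractionRing (N : Subring L)
    (hfr : ∀ y : L, ∃ a ∈ N, ∃ b ∈ N, y = a / b)
    (A₀ : Subalgebra (((algebraMap k K).comp (iterateFrobenius k p n)).fieldRange) K)
    (hA₀ : A₀.toSubring = N.map (IsPurelyInseparable.iterateFrobenius K L p hn)) (x : K) :
    x ^ p ^ n ∈ IntermediateField.adjoin (((algebraMap k K).comp (iterateFrobenius k p
    n)).fieldRange)
      (A₀ : Set K) := by
  set ρ := IsPurelyInseparable.iterateFrobenius K L p hn with hρ
  obtain ⟨a, ha, b, hb, hab⟩ := hfr (algebraMap K L x)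
  have hx : x ^ p ^ n = ρ a / ρ b := by
    rw [← IsPurelyInseparable.iterateFrobenius_algebraMap L p hn x, hab, map_div₀]
  rw [hx, IntermediateField.mem_adjoin_iff_div]
  refine ⟨ρ a, ?_, ρ b, ?_, rfl⟩
  · rw [Algebra.adjoin_eq]
    change ρ a ∈ A₀.toSubring
    rw [hA₀]
    exact ⟨a, ha, rfl⟩
  · rw [Algebra.adjoin_eq]
    change ρ b ∈ A₀.toSubring
    rw [hA₀]
    exact ⟨b, hb, rfl⟩

end BaseField

end Summit.ResolutionOfSingularities.ResolutionOfSingularities.Theorems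

end
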